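import Summits.BirchSwinnertonDyer.Rank1Residual.F1Sign2.TwoAdicBSDRankOneAtTwo
import Summits.BirchSwinnertonDyer.Rank1Residual.F1Sign2.KatzFrobeniusColumn
import Literature.NumberTheory.EllipticCurves.FormalGroup
import Literature.NumberTheory.EllipticCurves.Kato2004.LocPKummerLog
import HarnessLib

/-!
# Cell `bsd-f1-sign2`, lens `-es` (Euler system, explicit reciprocity at 2) g7, MEMO-es §16: the SUPERSINGULAR HALF of crux
# stmt-BirchSwinnertonDyer-23715 at `p = 2` in the η-CHANNEL — K2-Vss `TwoAdicBSDEtaValRankOneSs`, K2-Tss `TwoAdicShaAnTransferEtaRankOneSs`,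
# K2-Kss `TwoAdicKatoBoundEtaRankOneSs`, K2-Lss `TwoAdicLowerBoundEtaRankOneSs`, K2-Vss♭ `TwoAdicBSDFomegaValRankOneSs`, the halves
# `RankOneAtTwoBigImageOddLocalSs/Good`, receptacles D16-1…D16-4 WITH BODIES, PROVED glue (`glue16Ss`, `rankOneAtTwoGood_of_halves`, …) and D16-5

SIBLING MODULE of `F1Sign2/TwoAdicBSDRankOneAtTwo.lean` (ordinary half: K2-G/Gv/K/L/S₂, `RankOneAtTwoBigImageOddLocalOrd`, `Glue14Ord`; p596807 +
p608968 + p610404 + p614503) and of `F1Sign2/KatzFrobeniusColumn.lean` (ES-15-Φ: `IsKatzFrobeniusColumn`, `katzFrobeniusColumn_existsUnique`,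
`KatzFrobeniusColumnValAtTwo`, `matrix22_val`; p617813): imports both, restates nothing (the Sketch's self-contained copy of the Katz block, l.44–66, is
dropped in favour of the import). STATEMENTS ONLY: seven receptacle defs WITH BODIES (explicit formulas = ENGINE 4 of DES16), seven `@[conjecture]
def`s (conjecture-grade crux slices, nothing asserted — five η-channel rows + the two slice halves), one plain `def Glue16Ss : Prop` and its PROOF,
further PROVED glue and the D16-5 determinant lemmas; no `instance`, no `notation`, no named Literature fact, no `sorry`.

TYPER FILING (seat `bsd-f1-sign2-ty` g8; CANDIDATES.md rows ES-16-Vss/Tss/Kss/Lss/Vss♭/G/D; -es g7 CANDIDATES-delta 2026-08-28T08:30:51Z, MEMO-es §16.8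
filing advice «file into TwoAdicBSDRankOneAtTwo.lean §ss after ES-15-R/F land» — that module is at 373 lines with proofs (cap 400), hence this
sibling): bodies VERBATIM from `HOME/data-es/g7/Sketch16.lean` e3db762ec873888c l.68–338 (-es: farm rc 0 · 0 sorry · 0 warn; BC7 `Probe16*.txt`
5/5 CLEAN) — builder `tools/mk_es16.py` (published with the filed text under `HOME/MEMO-ty-data/g8/`) applies: this header (planner's module summary
verbatim below), one docstring (`isUnit_det_one_sub_pinv_frob`, lint), the §16.9 print-status rider on K2-Tss, the REF1, REF2 verdict paragraphs.
REF1-AUDIT §88 (refuter seat bsd-f1-sign2-ref1 g8, 2026-08-28T09:3xZ; D-ty-ref1-16 + MEMO-es §16 audit; evidence `HOME/REF1-data/b88/`: Probe88.lean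
6cbd9244b7f5d94e = this draft's body VERBATIM + audit lemmas e1–e7, farm rc 0 · 0 warn · 0 sorry; this draft 7bd34ce01f855b42 recompiled rc 0, rows
23/23 SAME vs Sketch16 e3db762ec873888c, axioms propext, Classical.choice, Quot.sound on all 8 proved decls): **-ty FILING GATE CLEARED to file as
is.** Verdicts: (i) the η-CHANNEL ELIMINATION OF HEIGHTS (MEMO-es §16.1) VERIFIED FROM PRINT with constant exactly 1 — Kurihara–Pollack 2007 (9)–(11)
[corpus p0021 L81–100, p0022 L1–18, L55–67]: the `D`-valued BSD of Bernardi–Perrin-Riou, `R_{p,α}` in rank 1, `h_{ω_E}(P) = −log_Ê(P)²`, and the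
height-FREE identity (11); the η-coefficient of Perrin-Riou's `D`-valued height is `∓log_ω(P)²` because `|[ω, xω]| = 1` for the Néron differential
(REF1's residue computation, choice-free; sign dies under `‖·‖`), and the analytic leading vector's η-coordinate is `v·B` when `Fω = uω + vη` (e6,
kernel, `u`-free) = `ssLeadingEta`; so K2-Vss is the printed `D`-valued conjecture PROJECTED FAITHFULLY onto η (the ω-component, carrying the genuine
height, is lost and nothing else). (ii) ROWS: K2-Vss `TwoAdicBSDEtaValRankOneSs` CLEARED conjecture-grade as typed; K2-Tss `TwoAdicShaAnTransferEtaRankOneSs`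
PRINT-grade support modulo Kobayashi 2013's own `p = 2` provisions, CLEARED (first conjunct `logOmegaAt W 2 (P 0) ≠ 0` theorem-grade, r1); K2-Kss,
K2-Lss NOT in print at 2 — the lens's beyond-print TARGETS, CLEARED conjecture-grade as typed; K2-Vss♭ PROVED from Vss ∧ K2-Φ (kernel); halves +
`rankOneAtTwoGood_of_halves` + `rankOneAtTwoBigImageOddLocalSs_of_crux` kernel, CLEARED. (iii) `Glue16Ss` hypotheses (1)–(9): each PRINT or a filed
candidate, none vacuous, none smuggling ((7) convergence: Višik, Amice–Vélu, MTT §11 — `h = ½ < 1`, both Frobenius slopes `½` for `a₂ ∈ {0, ±2}`; `L`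
unique); `glue16Ss` KERNEL. (iv) D16-5 `det_one_sub_pinv_frob` etc. KERNEL and exactly what removes the `Matrix.inv` junk from `ssLeadingEta`
(`det = N₂/2`, `N₂ = 3 − a₂ ∈ {3, 1, 5} ≠ 0`, e4). Riders r1–r5 docstring-level, optional — r1–r4 folded below, r5 = the existing «Why it might fail»
caveats, kept. Open question (non-blocking, for -ref2, human): BPR 1993 / Sprung 2015 Conj 1.2 at `p = 2` with `a₂ = ±2` not re-read by REF1.
PARTITION: none (23715 stands; the good half is typed as ord ∧ ss with both glues kernel, but K2-V, K2-Vss are conjecture rows). Beyond-print theorem: no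
(K2-Kss, K2-Lss are beyond-print TARGETS, conjecture-grade; the 8 proofs are elementary kernel support; BSD is not proved).
REF2-PLACEMENT v20-add1 §1 (72c43a195162eaf0, 2026-08-28T08:49Z/08:50Z; E-16-R answered, riders folded into the docstrings below): the D-valued / ♯♭ supersingular
p-adic BSD is FORMULATED at p = 2 in print (Bernardi–Perrin-Riou 1993; Sprung 2015 Conj 1.2 and the p = 2 rank criterion; Kurihara–Pollack 2007 (2.5));
typed here in the η-channel (heights eliminated) — a typing device, no novelty claim. Numerical checks of p-adic BSD against non-trivial Ш exist in print only
for ODD supersingular p (Perrin-Riou 2003, Exp. Math. 12, §6: p = 3, 5, 7, Ш ≠ 1 in §6.2); the cell's DES16 p = 2 check (7 curves, Ш_an = 4, N ≤ 40 331) has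
no printed precedent. K2-Tss PRINT at p = 2 (Kobayashi 2013 Cor 1.3(ii), parity-free p-adic Gross–Zagier); K2-Kss, K2-Lss NOT in print at p = 2 (Kato 2004
Thm 17.4 p ≠ 2; Kobayashi 2003 ±-Selmer and control «p an odd prime»; Sprung 2012 ♯/♭ — analytic objects include p = 2, the signed algebraic side does not;
Perrin-Riou 1993, Castella–Ciperiani–Skinner–Sprung lower bound p odd) — the beyond-print target of the lens (REF2 v18 §1/§4). PARTITION: none; beyond-print
theorem: no.
CENSUS / BC5 (-es g7 DES16; kit tag bsd-frontier-data: j301919 FULL 28 cores / 1 249 s / 107.6 GB, j302751, j302855; tables `HOME/data-es/des16/`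
DES16-SS-v1.tsv 9234715e1a4a2f56 (904 ss rows), DES16-PRE-v1.tsv 8afbe2597bfd25ca, SUMMARY16-v1.md 37ee42331ffc7c2a): first test of «the 2-adic L′
sees Ш» at a SUPERSINGULAR 2 outside every printed BSD₂ regime — the seven ss-at-2 rank-1 curves with Ш_an = 4, N ∈ [35 083, 40 331]: η-law
T1 = T2 = T3 = 0 on 7/7 (ENGINE 5 = eclib Riemann sums, PARI-free) and 5/5 sound-PARI rows, engines agreeing 5/5, η-channel analytic Ш
Se = 2²·unit on 7/7; block A (900 ss rank-1 class members N ≤ 5 000): 808/900 confirmed ≥ 3 surplus bits on all three laws, 92 precision-starved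
deep-point rows — CLOSED OUT at 30 digits (MEMO-es §16.10, j303263: T1 = T2 = T3 = 0 on 92/92; FINAL block A η-law ≥ 3 bits on 900/900, all three
laws 896/900, the 4 remaining rows capped by the 8-bit Katz column, two independent engines 802/900), **0 violations**; SHA-ss block now 7/7 on TWO
independent analytic engines (ENGINE 5 levels 20/22/24, kit j303633; PARI `ellpadicbsd`/direct `ellpadicL` incl. the two tw5-defect rows j304056:
v₂(η-channel analytic Ш) = 2 = v₂(Ш_an) on 14/14 engine-rows); PARI `ellpadicbsd` defect
re-found and classified (wrong exactly on minimal twists by D₀ ≡ 5 mod 8: 452/463; ENGINE 1′ direct `ellpadicL` 900/900 right); K2-Φ 907/907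
(cumulative 1 520/1 520). Cheapest falsifier of K2-Vss: one non-CM ss-at-2 rank-1 row with T1 ≠ 0 certified by two engines → 0/1 501 → NOT KILLED.
WHY (-es §16.0): in rank one the η = x·ω coordinate of the D-valued regulator is −log_ω(P)² for EVERY splitting, so the ss half needs NO p-adic
height, NO regulator receptacle and NO non-degeneracy crux; K2-Kss/K2-Lss are the two inequalities of the η-identity, beyond print at 2
(Sprung 2012 builds ♯/♭ Coleman maps at 2 but assumes p odd from §7 on; CCSS ♯/♭ main conjecture p > 2). PARTITION currency: 23715 = ord ∨ ss ∨
mult ∨ add at 2; the good-at-2 part is now typed end to end ((K2-K ∧ K2-L ∧ K2-S₂)|ord + (K2-Kss ∧ K2-Lss)|ss + PRINT), mult/add untouched.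
PARTITION: none moved; beyond-print theorem: no. bears_on: stmt-BirchSwinnertonDyer-23715 (supersingular third of the good-at-2 half).

Planner's module summary (verbatim, -es g7 Sketch16):
MEMO-es §16.  All statements are candidate `Prop`s over tree declarations (nothing asserted; no `sorry`),
plus PROVED kernel glue.  New objects (receptacles, all `def`s with explicit formulas = ENGINE 4 of DES16):

* `frobMatrixOmegaBasis W p = !![0, -p; 1, a_p]` — crystalline Frobenius `F` on `D = H¹_dR(W/ℚ_p)` in the basis
  `(ω, Fω)` (characteristic polynomial `X² − a_p X + p`; at a supersingular `p` this basis is defined over `ℚ_p`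
  although the eigenvalues `α, β` are not — slope `1/2`).
* `ssMeasure W p f n a ∈ ℚ_p²` — the `D`-valued modular-symbol distribution of Mazur–Tate–Teitelbaum §II.14 /
  Perrin-Riou / Bernardi–Perrin-Riou 1993 on `a + pⁿℤ_p`, written over the tree's `ratPlusSymbol f`:
  `x⁺(a/pⁿ)·(p⁻¹Φ)ⁿe₁ − x⁺(a/pⁿ⁻¹)·(p⁻¹Φ)ⁿ⁺¹e₁`, `e₁ = ω`.
* `ssLDerivRiemannSum W p f n = Σ_{0<a<pⁿ, p∤a} log_p(a) • μ_D(a + pⁿℤ_p)` and the receptacle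
  `IsSsLDerivVector W p f L :⇔ the Riemann sums → L` (`L = L_p^{(1)}(E, 𝟙) = ∫_{ℤ_p^×} log_p dμ_D ∈ D`, coordinates in `(ω, Fω)`).
  DES16 ENGINE 4 = exactly this sum in GP, checked against PARI `ellpadicL(E,2,n,0,1)` (agreement growing ≈ n/2 bits, sign included).
* `ssLeadingEta W p L v = v · ((1 − p⁻¹Φ)⁻² L)_{Fω}` — the `η = x·ω`-coordinate of the NORMALISED leading vector, given a
  Katz Frobenius column `(u, v)` of `F` in the basis `(ω, η)` (`Fω = u ω + v η`; receptacle `IsKatzFrobeniusColumn`, ES-15-Φ).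
* `logOmegaAt W p P = log_ω(P) ∈ ℚ_p` of a rational point through `E(ℚ_p)` (`Kato2004.padicLogLocal ∘ Point.map`).

THE η-CHANNEL OBSERVATION (why these statements need NO `p`-adic height and NO `D`-valued regulator receptacle):
in rank one the `D`-valued regulator is `h(P) = f·ω + g·η` with `g = -log_ω(P)²` INDEPENDENT of any choice
(`p`-adic sigma / splitting), so the `η`-coordinate of the BPR/MTT `D`-valued BSD formula reads
`ϖ · v · B · #E(ℚ)_tors² ~ #Ш · Tam · log_ω(P)²` — heights eliminated.  DES15/DES16 test it as `T1 = B·v_F − Ш_an·g = 0`.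

Candidates: K2-Vss `TwoAdicBSDEtaValRankOneSs` (valuation law, conjecture-grade = BPR 1993 at p = 2 in rank 1, η-part),
K2-Tss `TwoAdicShaAnTransferEtaRankOneSs` (archimedean transfer: `shaAn` rational with the same 2-adic norm identity and
`log_ω(P) ≠ 0`), K2-Vss♭ `TwoAdicBSDFomegaValRankOneSs` (column-free form via K2-Φ: factor `2`), the ss half
`RankOneAtTwoBigImageOddLocalSs`, PROVED glue `glue16Ss`, PROVED `good = ord ∨ ss` assembly `rankOneAtTwoGood_of_halves`.
-/

namespace Summit.BirchSwinnertonDyer.Rank1Residual.F1Sign2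

open Literature Literature.NumberTheory.EllipticCurves Literature.NumberTheory.EllipticCurves.ModularForms
open WeierstrassCurve PowerSeries Filter
open scoped Classical MatrixGroups ModularForm Topology
open CongruenceSubgroup

/-! ## D16: receptacles for the `D`-valued `p`-adic `L`-derivative at a supersingular prime (ENGINE 4, explicit) -/

/-- Matrix of crystalline Frobenius `F` on `D = H¹_dR(W/ℚ_p)` in the basis `(ω, Fω)`: `!![0, -p; 1, a_p]`. -/
noncomputable def frobMatrixOmegaBasis (W : WeierstrassCurve ℚ) [W.IsGloballyMinimal] (p : ℕ) [Fact p.Prime] :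
    Matrix (Fin 2) (Fin 2) ℚ_[p] :=
  !![0, -(p : ℚ_[p]); 1, (W.frobeniusTrace p : ℚ_[p])]

/-- The rational point `P ∈ W(ℚ)` viewed in `W(ℚ_p)`. -/
noncomputable def pointToPadic (W : WeierstrassCurve ℚ) (p : ℕ) [Fact p.Prime] (P : W.toAffine.Point) :
    (W.baseChange ℚ_[p]).toAffine.Point :=
  WeierstrassCurve.Affine.Point.map (Algebra.ofId ℚ ℚ_[p]) P

/-- `log_ω(P) ∈ ℚ_p`: the formal-group logarithm (w.r.t. the invariant differential `ω` of the minimal model) of a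
rational point, extended from the reduction kernel by `ℤ`-linearity (`Kato2004.padicLogLocal`). -/
noncomputable def logOmegaAt (W : WeierstrassCurve ℚ) [W.IsElliptic] [W.IsGloballyMinimal] (p : ℕ) [Fact p.Prime]
    (P : W.toAffine.Point) : ℚ_[p] :=
  Kato2004.padicLogLocal W p (pointToPadic W p P)

/-- **D16-1.** The `D`-valued distribution `μ_D(a + pⁿℤ_p) ∈ ℚ_p²` (coordinates in `(ω, Fω)`), `n ≥ 1`:
`x⁺(a/pⁿ)·(p⁻¹Φ)ⁿ e₁ − x⁺(a/pⁿ⁻¹)·(p⁻¹Φ)ⁿ⁺¹ e₁` with `x⁺ = ratPlusSymbol f`, `Φ = frobMatrixOmegaBasis`, `e₁ = (1,0)`.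
REF1 §88 rider r3: the distribution relation follows from `ℤ`-periodicity of `x⁺` and the `T_p`-Hecke relation via `Φ² − a_pΦ + p = 0`
(REF1 §88 e7, kernel). [MTT 1986 §II.14; Bernardi–Perrin-Riou 1993 §1] -/
noncomputable def ssMeasure (W : WeierstrassCurve ℚ) [W.IsGloballyMinimal] (p : ℕ) [Fact p.Prime]
    {N : ℕ} (f : CuspForm (Gamma0 N) 2) (n a : ℕ) : Fin 2 → ℚ_[p] :=
  ((ratPlusSymbol f ((a : ℚ) / (p : ℚ) ^ n) : ℚ) : ℚ_[p]) •
      Matrix.mulVec (((p : ℚ_[p])⁻¹ • frobMatrixOmegaBasis W p) ^ n) ![1, 0]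
  - ((ratPlusSymbol f ((a : ℚ) / (p : ℚ) ^ (n - 1)) : ℚ) : ℚ_[p]) •
      Matrix.mulVec (((p : ℚ_[p])⁻¹ • frobMatrixOmegaBasis W p) ^ (n + 1)) ![1, 0]

/-- **D16-2.** Level-`n` Riemann sum for `L_p^{(1)}(E, 𝟙) = ∫_{ℤ_p^×} log_p dμ_D` (ENGINE 4 of DES16, verbatim). -/
noncomputable def ssLDerivRiemannSum (W : WeierstrassCurve ℚ) [W.IsGloballyMinimal] (p : ℕ) [Fact p.Prime]
    {N : ℕ} (f : CuspForm (Gamma0 N) 2) (n : ℕ) : Fin 2 → ℚ_[p] :=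
  ∑ a ∈ (Finset.range (p ^ n)).filter (fun a => ¬ p ∣ a), padicLog p (a : ℚ_[p]) • ssMeasure W p f n a

/-- **D16-3 (RECEPTACLE).** `L ∈ ℚ_p²` is the `D`-valued first derivative of the `p`-adic `L`-function of `(W, f)` at the
trivial character, coordinates in `(ω, Fω)`: the Riemann sums converge to it. (Convergence for a `1/2`-admissible
distribution against the locally analytic `log_p` is a theorem — Višik / Amice–Vélu; filed as glue input, not asserted.) -/
def IsSsLDerivVector (W : WeierstrassCurve ℚ) [W.IsGloballyMinimal] (p : ℕ) [Fact p.Prime]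
    {N : ℕ} (f : CuspForm (Gamma0 N) 2) (L : Fin 2 → ℚ_[p]) : Prop :=
  Tendsto (ssLDerivRiemannSum W p f) atTop (𝓝 L)

/-- **D16-4.** `η`-coordinate of the normalised leading vector `(1 − p⁻¹Φ)⁻² L` in the basis `(ω, η)`, given the
second entry `v` of a Katz Frobenius column (`Fω = u ω + v η`): `v · ((1 − p⁻¹Φ)⁻² L)_{Fω}`. REF1 §88 (i), rider r4: this IS the
η-channel of the printed `D`-valued BSD (Kurihara–Pollack 2007 (9)–(11), pp. 21–22 of the held text: Bernardi–Perrin-Riou's conjecture, `R_{p,α}`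
in rank 1, `h_{ω_E}(P) = −log_Ê(P)²`, and the height-free identity (11)); `|[ω, xω]| = 1` for the Néron differential, so the η-projection carries
no hidden constant, and the η-coordinate `v·B` of `X = A·ω + B·Fω` is `u`-free (REF1 §88 e6, kernel); `(1 − p⁻¹Φ)⁻¹` is a genuine inverse
(`det = N_p/p ≠ 0`, `det_one_sub_pinv_frob` below). [cite: KuriharaPollack2007, (9)–(11)] -/
noncomputable def ssLeadingEta (W : WeierstrassCurve ℚ) [W.IsGloballyMinimal] (p : ℕ) [Fact p.Prime]
    (L : Fin 2 → ℚ_[p]) (v : ℚ_[p]) : ℚ_[p] :=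
  v * Matrix.mulVec ((1 - (p : ℚ_[p])⁻¹ • frobMatrixOmegaBasis W p)⁻¹ ^ 2) L 1

/-! ## §16 candidates (supersingular half of 23715) -/

/-- **K2-Vss (η-channel valuation law; conjecture-grade = Bernardi–Perrin-Riou 1993 `D`-valued BSD at `p = 2`, rank 1, η-part).**
On the 23715 slice, good supersingular at `2`, `r_an = 1`: for every newform `f` of `W`, every `D`-valued `L`-derivative vector `L`,
every Katz column `(u,v)`, every Mordell–Weil basis `P` of size one, if `Ш[2^∞]` is finite and `ϖ` is the period ratio then
`‖ϖ · Λ_η · #tors²‖₂ = ‖#Ш[2^∞] · log_ω(P₀)² · Tam‖₂`, `Λ_η = ssLeadingEta W 2 L v`.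
DES15 (601/601) + DES16 census: `T1 = B·v_F − Ш_an·g = 0` to ≥ 3 surplus bits on every non-CM rank-1 good-ss-at-2 row.
Why it might fail: the `D`-valued conjecture at `p = 2` is not in print with pinned normalisations (Tamagawa factor at 2-adically bad
primes, `Ω` vs `Ω⁺`, Manin constant); a class with `v₂(Tam) ≥ 4` or a non-optimal member could expose a missing factor.
PLACEMENT (REF2 v20-add1 §1): the `D`-valued, ♯♭ supersingular `p`-adic BSD is formulated at `p = 2` in print (Bernardi–Perrin-Riou 1993; Sprung 2015
Conj. 1.2 and the `p = 2` rank criterion; Kurihara–Pollack 2007 (2.5)); typed here in the η-channel (heights eliminated) — a typing device, no novelty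
claim. Numerical checks of `p`-adic BSD against non-trivial Ш exist in print only for ODD supersingular `p` (Perrin-Riou 2003, Exp. Math. 12, §6);
the DES16 `p = 2` check (7 curves, Ш_an = 4, N ≤ 40 331) has no printed precedent. [cite: BernardiPerrinRiou1993] [cite: Sprung2015, Conj. 1.2]
[cite: KuriharaPollack2007, (2.5)] [cite: PerrinRiou2003, §6] -/
@[conjecture] def TwoAdicBSDEtaValRankOneSs : Prop :=
  ∀ (W : WeierstrassCurve ℚ) [W.IsElliptic] [W.IsGloballyMinimal],
    SliceAtTwo W → W.HasGoodReductionAtPrime 2 → ¬ IsOrdinaryAt W 2 → W.analyticRank = 1 →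
    ∀ ⦃N : ℕ⦄ [NeZero N] (f : CuspForm (Gamma0 N) 2), IsNewformOf W f →
    ∀ L : Fin 2 → ℚ_[2], IsSsLDerivVector W 2 f L →
    ∀ u v : ℚ_[2], IsKatzFrobeniusColumn W 2 u v →
    ∀ P : Fin 1 → W.toAffine.Point, IsMordellWeilBasis P →
      Finite (AddCommGroup.primaryComponent W.sha 2) →
      ∀ ϖ : ℚ, (ϖ : ℝ) * W.realPeriodRat = plusPeriod f →
        ‖(ϖ : ℚ_[2]) * ssLeadingEta W 2 L v * (W.torsionOrder : ℚ_[2]) ^ 2‖ =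
          ‖(Nat.card (AddCommGroup.primaryComponent W.sha 2) : ℚ_[2]) * (logOmegaAt W 2 (P 0)) ^ 2 *
              W.tamagawaProduct‖

/-- **K2-Tss (archimedean transfer, η-channel; lens -an: 2-adic Gross–Zagier at supersingular 2).** Same binders:
`log_ω(P₀) ≠ 0` (the point has infinite order; formal log injective mod torsion) and `shaAn W` is a RATIONAL `q` with
`‖ϖ · Λ_η · #tors²‖₂ = ‖q · log_ω(P₀)² · Tam‖₂`.  With GZK + Kolyvagin this and K2-Vss give `BSDp W 2` (glue16Ss).
In print: Kobayashi 2013 (Invent. 191) Cor. 1.3(ii) `L'_p(E,α,1) = (1-1/α)² C(E) ⟨P,P⟩_{p,α}` for "a good prime p" as printed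
(the paper flags `p = 2` as "subtle", p. 605/608); this is its η-projection at `p = 2` in the `(ω,Fω)` basis. PRINT STATUS AT `p = 2`
(MEMO-es §16.9 rider, REF2 v18 §2): Kobayashi 2013 Cor. 1.3(ii) is parity-free in `p` as printed (supersingular case); Disegni 2017/2022 cover
the ORDINARY case — so this row is PRINT-grade support, typed `@[conjecture]` only for want of a `p`-adic Gross–Zagier formula in the tree.
Why it might fail: the `p = 2` case of Kobayashi's height/theta-function comparison (§4.5) and the Manin-constant / `Ω` vs `Ω⁺`
normalisations at `2` are not pinned in print; a non-optimal class member could expose a missing factor. REF1 §88 (CLEARED, PRINT-grade support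
modulo Kobayashi 2013's own `p = 2` provisions); rider r1: the conjunct `logOmegaAt W 2 (P 0) ≠ 0` is THEOREM-grade (REF1 §88 e5 + AEC IV.6.4(b):
the `ℤ`-linear extension of the formal log kills exactly torsion, and `P 0` of a rank-1 Mordell–Weil basis is non-torsion); it may later be split
off as a proved lemma. -/
@[conjecture] def TwoAdicShaAnTransferEtaRankOneSs : Prop :=
  ∀ (W : WeierstrassCurve ℚ) [W.IsElliptic] [W.IsGloballyMinimal],
    SliceAtTwo W → W.HasGoodReductionAtPrime 2 → ¬ IsOrdinaryAt W 2 → W.analyticRank = 1 →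
    ∀ ⦃N : ℕ⦄ [NeZero N] (f : CuspForm (Gamma0 N) 2), IsNewformOf W f →
    ∀ L : Fin 2 → ℚ_[2], IsSsLDerivVector W 2 f L →
    ∀ u v : ℚ_[2], IsKatzFrobeniusColumn W 2 u v →
    ∀ P : Fin 1 → W.toAffine.Point, IsMordellWeilBasis P →
    ∀ ϖ : ℚ, (ϖ : ℝ) * W.realPeriodRat = plusPeriod f →
      logOmegaAt W 2 (P 0) ≠ 0 ∧
      ∃ q : ℚ, shaAn W = (q : ℂ) ∧
        ‖(ϖ : ℚ_[2]) * ssLeadingEta W 2 L v * (W.torsionOrder : ℚ_[2]) ^ 2‖ =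
          ‖(q : ℚ_[2]) * (logOmegaAt W 2 (P 0)) ^ 2 * W.tamagawaProduct‖

/-- **K2-Kss (Kato-side inequality of K2-Vss; lens -es).** Same binders as K2-Vss; conclusion
`‖ϖ · Λ_η · #tors²‖₂ ≤ ‖#Ш[2^∞] · log_ω(P₀)² · Tam‖₂`, i.e. `v₂(analytic η-coefficient) ≥ v₂(#Ш[2^∞]·log²·Tam/#tors²)` —
the shape an Euler-system upper bound on the 2-primary Selmer group takes after K2-Tss.  NOT in print at `p = 2`:
Sprung 2012 (JNT 132) builds the `♯/♭` Coleman maps at `p = 2` (§§2–6) but the signed Selmer groups and the Kato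
divisibility (Thm 7.16) assume `p` odd (§7, "From now on, assume p is odd").
Why it might fail: Kato's divisibility at `p = 2` needs the `2`-adic image hypothesis in a form (`ρ` surjective onto `GL₂(ℤ₂)`)
whose sufficiency at `p = 2` is unverified in print (acq-13127); the signed local condition at `2` may differ from Honda type `♯/♭`.
PLACEMENT (REF2 v20-add1 §1): NOT in print at `p = 2` — printed shapes are for odd `p` (Kato 2004 Thm 17.4, `p ≠ 2`; Kobayashi 2003 ±-Selmer and
control «p an odd prime»; Sprung 2012 ♯/♭: the analytic objects include `p = 2`, the signed algebraic side does not); beyond-print target of the lens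
(REF2 v18 §1/§4). [cite: Kato2004Asterisque, Thm. 17.4 (p ≠ 2)] [cite: Kobayashi2003, (p odd)] [cite: Sprung2012] -/
@[conjecture] def TwoAdicKatoBoundEtaRankOneSs : Prop :=
  ∀ (W : WeierstrassCurve ℚ) [W.IsElliptic] [W.IsGloballyMinimal],
    SliceAtTwo W → W.HasGoodReductionAtPrime 2 → ¬ IsOrdinaryAt W 2 → W.analyticRank = 1 →
    ∀ ⦃N : ℕ⦄ [NeZero N] (f : CuspForm (Gamma0 N) 2), IsNewformOf W f →
    ∀ L : Fin 2 → ℚ_[2], IsSsLDerivVector W 2 f L →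
    ∀ u v : ℚ_[2], IsKatzFrobeniusColumn W 2 u v →
    ∀ P : Fin 1 → W.toAffine.Point, IsMordellWeilBasis P →
      Finite (AddCommGroup.primaryComponent W.sha 2) →
      ∀ ϖ : ℚ, (ϖ : ℝ) * W.realPeriodRat = plusPeriod f →
        ‖(ϖ : ℚ_[2]) * ssLeadingEta W 2 L v * (W.torsionOrder : ℚ_[2]) ^ 2‖ ≤
          ‖(Nat.card (AddCommGroup.primaryComponent W.sha 2) : ℚ_[2]) * (logOmegaAt W 2 (P 0)) ^ 2 *
              W.tamagawaProduct‖

/-- **K2-Lss (the reverse inequality; main-conjecture / Kolyvagin-index side).** Same binders; `≥`.  At odd ss `p` this is the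
`♯/♭` main conjecture (Wan, Castella–Çiperiani–Skinner–Sprung arXiv:1804.10993, `p > 2`); nothing at `p = 2`.
Why it might fail: BSD₂-strength lower bound for `#Ш[2^∞]` on the ss half of the slice; no method in print reaches `p = 2`.
PLACEMENT (REF2 v20-add1 §1): NOT in print at `p = 2` (Perrin-Riou 1993; Castella–Ciperiani–Skinner–Sprung ♯/♭ main conjecture, `p` odd).
[cite: PerrinRiou1993AIF, (p odd)] [cite: CastellaCiperianiSkinnerSprung2018, (p > 2)] -/
@[conjecture] def TwoAdicLowerBoundEtaRankOneSs : Prop :=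
  ∀ (W : WeierstrassCurve ℚ) [W.IsElliptic] [W.IsGloballyMinimal],
    SliceAtTwo W → W.HasGoodReductionAtPrime 2 → ¬ IsOrdinaryAt W 2 → W.analyticRank = 1 →
    ∀ ⦃N : ℕ⦄ [NeZero N] (f : CuspForm (Gamma0 N) 2), IsNewformOf W f →
    ∀ L : Fin 2 → ℚ_[2], IsSsLDerivVector W 2 f L →
    ∀ u v : ℚ_[2], IsKatzFrobeniusColumn W 2 u v →
    ∀ P : Fin 1 → W.toAffine.Point, IsMordellWeilBasis P →
      Finite (AddCommGroup.primaryComponent W.sha 2) →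
      ∀ ϖ : ℚ, (ϖ : ℝ) * W.realPeriodRat = plusPeriod f →
        ‖(Nat.card (AddCommGroup.primaryComponent W.sha 2) : ℚ_[2]) * (logOmegaAt W 2 (P 0)) ^ 2 *
              W.tamagawaProduct‖ ≤
          ‖(ϖ : ℚ_[2]) * ssLeadingEta W 2 L v * (W.torsionOrder : ℚ_[2]) ^ 2‖

/-- **K2-Vss♭ (column-free form; K2-Vss ∧ K2-Φ ⇒ this, PROVED below).** With the raw `Fω`-coordinate
`Λ_B = ssLeadingEta W 2 L 1` the identity reads `‖ϖ · Λ_B · #tors²‖₂ = 2 · ‖#Ш[2^∞] · log_ω(P₀)² · Tam‖₂`. -/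
@[conjecture] def TwoAdicBSDFomegaValRankOneSs : Prop :=
  ∀ (W : WeierstrassCurve ℚ) [W.IsElliptic] [W.IsGloballyMinimal],
    SliceAtTwo W → W.HasGoodReductionAtPrime 2 → ¬ IsOrdinaryAt W 2 → W.analyticRank = 1 →
    ∀ ⦃N : ℕ⦄ [NeZero N] (f : CuspForm (Gamma0 N) 2), IsNewformOf W f →
    ∀ L : Fin 2 → ℚ_[2], IsSsLDerivVector W 2 f L →
    (∃ u v : ℚ_[2], IsKatzFrobeniusColumn W 2 u v) →
    ∀ P : Fin 1 → W.toAffine.Point, IsMordellWeilBasis P →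
      Finite (AddCommGroup.primaryComponent W.sha 2) →
      ∀ ϖ : ℚ, (ϖ : ℝ) * W.realPeriodRat = plusPeriod f →
        ‖(ϖ : ℚ_[2]) * ssLeadingEta W 2 L 1 * (W.torsionOrder : ℚ_[2]) ^ 2‖ =
          2 * ‖(Nat.card (AddCommGroup.primaryComponent W.sha 2) : ℚ_[2]) * (logOmegaAt W 2 (P 0)) ^ 2 *
              W.tamagawaProduct‖

/-- The SUPERSINGULAR half of crux 23715 (`good at 2 ∧ ¬ ordinary` = `2 ∣ a₂`). -/
@[conjecture] def RankOneAtTwoBigImageOddLocalSs : Prop :=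
  ∀ (W : WeierstrassCurve ℚ) [W.IsElliptic] [W.IsGloballyMinimal],
    SliceAtTwo W → W.HasGoodReductionAtPrime 2 → ¬ IsOrdinaryAt W 2 → W.analyticRank = 1 → BSDp W 2

/-- The GOOD-AT-2 part of crux 23715 (ordinary ∨ supersingular). -/
@[conjecture] def RankOneAtTwoBigImageOddLocalGood : Prop :=
  ∀ (W : WeierstrassCurve ℚ) [W.IsElliptic] [W.IsGloballyMinimal],
    SliceAtTwo W → W.HasGoodReductionAtPrime 2 → W.analyticRank = 1 → BSDp W 2

/-- Sanity: the ss half is implied by the crux itself. -/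
theorem rankOneAtTwoBigImageOddLocalSs_of_crux
    (h : Summit.BirchSwinnertonDyer.BirchSwinnertonDyer.Theses.ByReductionTypeAtTwo.RankOneAtTwoBigImageOddLocal) :
    RankOneAtTwoBigImageOddLocalSs := by
  intro W _ _ hs _ _ hr
  exact h W hs.1 hs.2.1 hs.2.2.1 hs.2.2.2 hr

/-- **Assembly of the good-at-2 case (PROVED): ordinary half ∧ supersingular half ⇒ good half.** -/
theorem rankOneAtTwoGood_of_halves (hord : RankOneAtTwoBigImageOddLocalOrd) (hss : RankOneAtTwoBigImageOddLocalSs) :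
    RankOneAtTwoBigImageOddLocalGood := by
  intro W _ _ hs hgood hr
  by_cases h : IsOrdinaryAt W 2
  · exact hord W hs h hr
  · exact hss W hs hgood h hr

/-- **Glue16Ss (support).** K2-Vss and K2-Tss with the printed inputs GZK, Kolyvagin, modularity, the period ratio,
CONVERGENCE of the `D`-valued Riemann sums (Višik / Amice–Vélu: the receptacle is inhabited), EXISTENCE of the Katz column
at a supersingular prime (ES-15-F) and of a Mordell–Weil basis of size `rank`, give the supersingular half of 23715. -/
def Glue16Ss : Prop :=
  TwoAdicBSDEtaValRankOneSs → TwoAdicShaAnTransferEtaRankOneSs →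
  (∀ (W : WeierstrassCurve ℚ) [W.IsElliptic], W.analyticRank ≤ 1 → W.mordellWeilRank = W.analyticRank) →
  (∀ (W : WeierstrassCurve ℚ) [W.IsElliptic], W.analyticRank ≤ 1 → Finite W.sha) →
  (∀ (W : WeierstrassCurve ℚ) [W.IsElliptic], ∃ N : ℕ, ∃ _ : NeZero N, ∃ f : CuspForm (Gamma0 N) 2,
      IsNewformOf W f) →
  (∀ (W : WeierstrassCurve ℚ) [W.IsElliptic] [W.IsGloballyMinimal] ⦃N : ℕ⦄ [NeZero N]
      (f : CuspForm (Gamma0 N) 2), IsNewformOf W f → ∃ ϖ : ℚ, (ϖ : ℝ) * W.realPeriodRat = plusPeriod f) →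
  (∀ (W : WeierstrassCurve ℚ) [W.IsElliptic] [W.IsGloballyMinimal] ⦃N : ℕ⦄ [NeZero N]
      (f : CuspForm (Gamma0 N) 2), IsNewformOf W f → W.HasGoodReductionAtPrime 2 → ¬ IsOrdinaryAt W 2 →
      ∃ L : Fin 2 → ℚ_[2], IsSsLDerivVector W 2 f L) →
  (∀ (W : WeierstrassCurve ℚ) [W.IsElliptic] [W.IsGloballyMinimal], W.HasGoodReductionAtPrime 2 → ¬ IsOrdinaryAt W 2 →
      ∃ u v : ℚ_[2], IsKatzFrobeniusColumn W 2 u v) →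
  (∀ (W : WeierstrassCurve ℚ) [W.IsElliptic], W.mordellWeilRank = 1 →
      ∃ P : Fin 1 → W.toAffine.Point, IsMordellWeilBasis P) →
  RankOneAtTwoBigImageOddLocalSs

/-- **`Glue16Ss` (PROVED; logic, casts and `‖·‖₂ ↔ v₂` only).** REF1 §88 rider r2: `Odd Tam` (from the slice) is used ONLY for `Tam ≠ 0`,
which holds unconditionally; hypotheses (1)–(9) each PRINT or a filed candidate, none vacuous (REF1 §88 (iii)). -/
theorem glue16Ss : Glue16Ss := by
  intro hV hT hGZK hKoly hMod hPer hL hKatz hMW W _ _ hS hgood hss hr1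
  have hle : W.analyticRank ≤ 1 := hr1.le
  haveI : Finite W.sha := hKoly W hle
  haveI hfin : Finite (AddCommGroup.primaryComponent W.sha 2) := inferInstance
  have hrk : W.mordellWeilRank = W.analyticRank := hGZK W hle
  refine ⟨hrk, hfin, ?_⟩
  obtain ⟨N, hN, f, hf⟩ := hMod W
  obtain ⟨ϖ, hϖ⟩ := hPer W f hf
  obtain ⟨L, hLL⟩ := hL W f hf hgood hss
  obtain ⟨u, v, huv⟩ := hKatz W hgood hss
  obtain ⟨P, hP⟩ := hMW W (hrk.trans hr1)
  have h1 := hV W hS hgood hss hr1 f hf L hLL u v huv P hP hfin ϖ hϖ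
  obtain ⟨hlog, q, hq, h2⟩ := hT W hS hgood hss hr1 f hf L hLL u v huv P hP ϖ hϖ
  refine ⟨q, hq, ?_⟩
  have h3 := h1.symm.trans h2
  have hTam0 : W.tamagawaProduct ≠ 0 := fun h0 ↦ by
    have := hS.2.2.2
    rw [h0] at this
    exact (Nat.not_odd_zero this).elim
  have hTam : (W.tamagawaProduct : ℚ_[2]) ≠ 0 := by exact_mod_cast hTam0
  have hcard0 : Nat.card (AddCommGroup.primaryComponent W.sha 2) ≠ 0 := Nat.card_pos.ne'
  simp only [norm_mul] at h3
  have hl' : 0 < ‖(logOmegaAt W 2 (P 0)) ^ 2‖ := norm_pos_iff.mpr (pow_ne_zero _ hlog)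
  have hT' : 0 < ‖(W.tamagawaProduct : ℚ_[2])‖ := norm_pos_iff.mpr hTam
  have h5 := mul_right_cancel₀ hT'.ne' h3
  have h4 : ‖((Nat.card (AddCommGroup.primaryComponent W.sha 2) : ℕ) : ℚ_[2])‖ = ‖((q : ℚ) : ℚ_[2])‖ :=
    mul_right_cancel₀ hl'.ne' h5
  exact padicValRat_eq_padicValNat_of_norm_eq hcard0 h4

/-- **K2-Vss ∧ K2-Φ ⇒ K2-Vss♭ (PROVED):** `‖v‖₂ = 1/2` turns the η-channel identity into the column-free one with the factor `2`. -/
theorem twoAdicBSDFomegaValRankOneSs_of_eta (hV : TwoAdicBSDEtaValRankOneSs) (hΦ : KatzFrobeniusColumnValAtTwo) :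
    TwoAdicBSDFomegaValRankOneSs := by
  intro W _ _ hS hgood hss hr1 N _ f hf L hLL huv P hP hfin ϖ hϖ
  obtain ⟨u, v, huv⟩ := huv
  have h1 := hV W hS hgood hss hr1 f hf L hLL u v huv P hP hfin ϖ hϖ
  have hv : ‖v‖ = 2⁻¹ := (hΦ W hgood hss u v huv).1
  have key : ssLeadingEta W 2 L v = v * ssLeadingEta W 2 L 1 := by
    simp [ssLeadingEta]
  rw [key] at h1
  have e1 : ‖(ϖ : ℚ_[2]) * (v * ssLeadingEta W 2 L 1) * (W.torsionOrder : ℚ_[2]) ^ 2‖ =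
      2⁻¹ * ‖(ϖ : ℚ_[2]) * ssLeadingEta W 2 L 1 * (W.torsionOrder : ℚ_[2]) ^ 2‖ := by
    simp only [norm_mul, hv]; ring
  rw [e1] at h1
  rw [← h1]; ring

/-- K2-Kss ∧ K2-Lss ⇒ K2-Vss (the equality is the two inequalities). -/
theorem twoAdicBSDEtaValRankOneSs_of_bounds (hK : TwoAdicKatoBoundEtaRankOneSs) (hL : TwoAdicLowerBoundEtaRankOneSs) :
    TwoAdicBSDEtaValRankOneSs := by
  intro W _ _ hsl hgood hss hr N _ f hf L hL' u v huv P hP hfin ϖ hϖ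
  exact le_antisymm (hK W hsl hgood hss hr f hf L hL' u v huv P hP hfin ϖ hϖ)
    (hL W hsl hgood hss hr f hf L hL' u v huv P hP hfin ϖ hϖ)

/-! ## D16-5: junk-value audit of the normalising operator `1 − p⁻¹Φ` (no exceptional zero at a good prime) -/

/-- The determinant of the normalising operator `1 − p⁻¹Φ` on `D` is `N_p / p` with `N_p = #W̃(𝔽_p)`
(`reductionPointCount`), i.e. the value at `s = 1` of the Euler factor `det(1 − Φ p^{-s})`; in particular it is
NON-ZERO at every prime, so the matrix inverse inside `ssLeadingEta` is the honest inverse (Mathlib's `Matrix.inv`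
returns `0` on singular matrices) — the `D`-valued formula has no exceptional-zero degeneracy at a good
supersingular `2` (`N₂ ∈ {1, 3, 5}` there). -/
theorem det_one_sub_pinv_frob (W : WeierstrassCurve ℚ) [W.IsGloballyMinimal] (p : ℕ) [Fact p.Prime] :
    (1 - (p : ℚ_[p])⁻¹ • frobMatrixOmegaBasis W p).det
      = (W.reductionPointCount p : ℚ_[p]) * (p : ℚ_[p])⁻¹ := by
  have hp : (p : ℚ_[p]) ≠ 0 := by exact_mod_cast (Fact.out : p.Prime).ne_zero
  simp only [frobMatrixOmegaBasis, WeierstrassCurve.frobeniusTrace, Matrix.det_fin_two, Matrix.sub_apply,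
    Matrix.one_apply_eq, Matrix.one_apply_ne (by decide : (0 : Fin 2) ≠ 1),
    Matrix.one_apply_ne (by decide : (1 : Fin 2) ≠ 0), Matrix.smul_apply, Matrix.of_apply, Matrix.cons_val',
    Matrix.cons_val_zero, Matrix.cons_val_one, Matrix.empty_val',
    Matrix.cons_val_fin_one, smul_eq_mul]
  push_cast
  field_simp
  ring

/-- Hence `det(1 − p⁻¹Φ)` is a unit of `ℚ_p` (`N_p ≥ 1`). -/
theorem isUnit_det_one_sub_pinv_frob (W : WeierstrassCurve ℚ) [W.IsGloballyMinimal] (p : ℕ) [Fact p.Prime] :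
    IsUnit (1 - (p : ℚ_[p])⁻¹ • frobMatrixOmegaBasis W p).det := by
  have hp : (p : ℚ_[p]) ≠ 0 := by exact_mod_cast (Fact.out : p.Prime).ne_zero
  rw [det_one_sub_pinv_frob, isUnit_iff_ne_zero]
  exact mul_ne_zero (by exact_mod_cast (W.reductionPointCount_pos p).ne') (inv_ne_zero hp)

/-- Hence `(1 − p⁻¹Φ)⁻¹` is a genuine two-sided inverse. -/
theorem one_sub_pinv_frob_mul_inv (W : WeierstrassCurve ℚ) [W.IsGloballyMinimal] (p : ℕ) [Fact p.Prime] :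
    (1 - (p : ℚ_[p])⁻¹ • frobMatrixOmegaBasis W p) * (1 - (p : ℚ_[p])⁻¹ • frobMatrixOmegaBasis W p)⁻¹ = 1 :=
  Matrix.mul_nonsing_inv _ (isUnit_det_one_sub_pinv_frob W p)

end Summit.BirchSwinnertonDyer.Rank1Residual.F1Sign2
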